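import Summits.QuantumAdvantage.QuantumAdvantage.Theorems.CubicForrelationNearExactIsExactMmFormCeilingA
import Summits.QuantumAdvantage.QuantumAdvantage.Theorems.CubicForrelationNearExactIsExactMmFormCeiling
import Summits.QuantumAdvantage.QuantumAdvantage.Theorems.CubicForrelationNearExactIsExactRothausB

/-!
# Crux `CubicForrelation.NearExactIsExact` (stmt-QuantumAdvantage-14043), line `direct-sum-amplification` —
stub TRANSFER: MM-shape crosses a near-exact pair

TRANSFER OF MM-SHAPE ACROSS A NEAR-EXACT PAIR (`tr_affine_of_mm_perm`). Let `f` be cubic on `m + m` bits, let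
`g` be in Maiorana–McFarland SIGN FORM `(-1)^{g(y₁ ‖ y₂)} = (-1)^{y₁·π(y₂)} (-1)^{h(y₂)}` with `π` coordinatewise
quadratic and SURJECTIVE (the bent case; `h` arbitrary), and suppose `Φ(f,g) > 15/16`. Then `f(x₁ ‖ ·)` is affine
for every `x₁`: all second differences in the `x₂`-block vanish,
`f(x₁‖x₂) ⊕ f(x₁‖x₂⊕u) ⊕ f(x₁‖x₂⊕v) ⊕ f(x₁‖x₂⊕u⊕v) = 0`. (So `f` has the dual M-subspace `{0} × 𝔽₂^m`, and the
conjecture "`Φ ∈ (7/8, 1)` forces both sides to be MM-shaped" needs only the `g`-side.) The MM Walsh identity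
`Φ = 2^{-2m} Σ_{y₂} (-1)^{h y₂} Σ_{x₂} (-1)^{f(π y₂ ‖ x₂)} (-1)^{x₂·y₂}` (stub F1, landed as `stub_mmWalsh`) is taken
as the explicit first hypothesis, exactly as in `stub_mmFormCeiling`.

Proof = the AFFINENESS TEST of `stub_mmFormCeiling` (first case of that proof), made unconditional by the landed
stubs D (`stub_derivDegree`) and R (`bb_rmWeight_holds`), followed by surjectivity of `π` and an elementary
"coordinate second differences control all second differences" lemma:

* `tr_coord_second_deriv_eq_false`: with the fibre functions `q_y = f(π y ‖ ·) ⊕ ℓ_y` (`fc_linForm_exists`) one has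
  `2^{2m} Φ = Σ_y (-1)^{h y} S(y)`, `S(y) = Σ_x (-1)^{q_y x}`, `|S(y)| ≤ 2^m`. The second coordinate derivatives
  `(D₂ᵢⱼ f)(π y ‖ x)` of the fibres have degree `≤ 1` in `x` (D, twice) and degree `≤ 2` in `y` (degree under the
  quadratic substitution `y ↦ (π y ‖ x)`, `fc_isDegLeFun_comp` / `fc_deg_coord_append_pi`). If some
  `(D₂ᵢⱼ f)(π y₀ ‖ x₀) = 1`, then `y ↦ (D₂ᵢⱼ f)(π y ‖ x₀)` is a nonzero function of degree `≤ 2`, so it is `1` on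
  `≥ 2^m/4` of the `y` (R, `d = 2`); each such fibre takes both values (`fc_fibre_both`), hence has
  `|S(y)| ≤ (3/4) 2^m` (`fc_bias`, R with `d = 3`), and averaging (`tr_avg_quarter`) gives
  `Σ_y |S(y)| ≤ (15/16) 4^m`, i.e. `Φ ≤ 15/16` — contradiction. So every `(D₂ᵢⱼ f)(π y ‖ x)` vanishes.
* `tr_second_diff_of_coord`: if all coordinate second differences `D_{eᵢ} D_{eⱼ} F` of `F : {0,1}^m → {0,1}` vanish,
  then every `D_{eᵢ} F` is constant (`fc_const_of_shift`), hence every `D_v F` is invariant under all coordinate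
  flips, hence constant, hence every `D_u D_v F` vanishes.
* `tr_affine_of_mm_perm`: every `x₁` is some `π y` (surjectivity); apply the two lemmas to `F = f(x₁ ‖ ·)`.

Orientation: C. Carlet, Boolean Functions for Cryptography and Coding Theory (CUP 2021), §2.2 (derivatives,
Reed–Muller weights) and §6.1 (Maiorana–McFarland class); no cited fact is used — everything is proved from the tree
(`fc_*` of `…MmFormCeilingA`, `stub_derivDegree`, `bb_rmWeight_holds`) and Mathlib.
-/

set_option linter.dupNamespace false -- D-0017: single-problem summit ⇒ `QuantumAdvantage.QuantumAdvantage` by design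

noncomputable section

namespace Summit.QuantumAdvantage.QuantumAdvantage.Theorems.CubicForrelation.NearExactIsExact

open Finset
open Literature.Computability.QuantumComplexity
open Literature.Computability.QuantumComplexity.BuzetChailloux (bxor zeroVec bxor_zeroVec bxor_comm)

variable {m : ℕ}

/-! ### Boolean bookkeeping -/

/-- `a ⊕ b = e` and `c ⊕ d = e` give `b ⊕ d = a ⊕ c`. -/
theorem tr_bool_transfer : ∀ a b c d e : Bool, (a ^^ b) = e → (c ^^ d) = e → (b ^^ d) = (a ^^ c) := by decide

/-- `a ⊕ b = e` and `c ⊕ d = e` give `a ⊕ b ⊕ c ⊕ d = 0`. -/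
theorem tr_bool_four : ∀ a b c d e : Bool, (a ^^ b) = e → (c ^^ d) = e → (a ^^ b ^^ c ^^ d) = false := by decide

/-! ### Averaging -/

/-- **Averaging with a quarter of deficient fibres.** If `|S y| ≤ 2^m` for all `y`, `|S y| ≤ (3/4)·2^m` on a set `s`
with `4·#s ≥ 2^m`, then `Σ_y |S y| ≤ (15/16)·4^m`. -/
theorem tr_avg_quarter (S : (Fin m → Bool) → ℝ) (hS : ∀ y, |S y| ≤ (2 : ℝ) ^ m) (s : Finset (Fin m → Bool))
    (hb : ∀ y ∈ s, |S y| ≤ 3 / 4 * (2 : ℝ) ^ m) (hs : (2 : ℝ) ^ m ≤ 4 * s.card) :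
    ∑ y, |S y| ≤ 15 / 16 * ((2 : ℝ) ^ m * 2 ^ m) := by
  classical
  rw [← sum_add_sum_compl s fun y => |S y|]
  have hin : ∑ y ∈ s, |S y| ≤ s.card * (3 / 4 * (2 : ℝ) ^ m) := by
    rw [← nsmul_eq_mul]; exact sum_le_card_nsmul _ _ _ hb
  have hout : ∑ y ∈ sᶜ, |S y| ≤ (sᶜ).card * (2 : ℝ) ^ m := by
    rw [← nsmul_eq_mul]; exact sum_le_card_nsmul _ _ _ fun y _ => hS y
  have hcard : ((s.card : ℝ) + ((sᶜ).card : ℝ)) * 2 ^ m = 2 ^ m * 2 ^ m := by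
    rw [← Nat.cast_add, s.card_add_card_compl, Fintype.card_fun, Fintype.card_bool, Fintype.card_fin]
    push_cast
    rfl
  have hprod : (2 : ℝ) ^ m * 2 ^ m ≤ 4 * s.card * 2 ^ m := mul_le_mul_of_nonneg_right hs (by positivity)
  linarith [add_mul (s.card : ℝ) ((sᶜ).card : ℝ) ((2 : ℝ) ^ m)]

/-! ### Coordinate second differences control all second differences -/

/-- A Boolean function all of whose coordinate second differences `D_{eᵢ} D_{eⱼ} F` vanish has ALL second
differences zero: `F x ⊕ F(x ⊕ u) ⊕ F(x ⊕ v) ⊕ F(x ⊕ (u ⊕ v)) = 0` (each `D_{eᵢ} F` is constant by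
`fc_const_of_shift`, hence every `D_u F` is flip-invariant, hence constant). -/
theorem tr_second_diff_of_coord (F : (Fin m → Bool) → Bool)
    (h2 : ∀ (i j : Fin m) (x : Fin m → Bool), ((F x ^^ F (bxor x (Pi.single i true))) ^^
      (F (bxor x (Pi.single j true)) ^^ F (bxor (bxor x (Pi.single j true)) (Pi.single i true)))) = false)
    (u v x : Fin m → Bool) :
    (F x ^^ F (bxor x u) ^^ F (bxor x v) ^^ F (bxor x (bxor u v))) = false := by
  have hrc : ∀ a b c : Fin m → Bool, bxor (bxor a b) c = bxor (bxor a c) b := fun a b c =>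
    funext fun k => Bool.xor_right_comm (a k) (b k) (c k)
  have hac : ∀ a b c : Fin m → Bool, bxor (bxor a c) b = bxor a (bxor b c) := fun a b c =>
    funext fun k => by
      show ((a k ^^ c k) ^^ b k) = (a k ^^ (b k ^^ c k))
      rw [Bool.xor_right_comm, Bool.xor_assoc]
  -- each coordinate first difference `D_{eᵢ} F` is constant
  have h1 : ∀ (i : Fin m) (x : Fin m → Bool), (F x ^^ F (bxor x (Pi.single i true))) =
      (F zeroVec ^^ F (bxor zeroVec (Pi.single i true))) := fun i =>
    fc_const_of_shift (fun x => F x ^^ F (bxor x (Pi.single i true))) fun j x =>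
      fc_bool_xor_eq_false _ _ (h2 i j x)
  -- hence every first difference `D_w F` is invariant under coordinate flips, hence constant
  have hw : ∀ (w x : Fin m → Bool), (F x ^^ F (bxor x w)) = (F zeroVec ^^ F (bxor zeroVec w)) := fun w =>
    fc_const_of_shift (fun x => F x ^^ F (bxor x w)) fun i x => by
      show (F (bxor x (Pi.single i true)) ^^ F (bxor (bxor x (Pi.single i true)) w)) = (F x ^^ F (bxor x w))
      rw [hrc x (Pi.single i true) w]
      exact tr_bool_transfer _ _ _ _ _ (h1 i x) (h1 i (bxor x w))
  have e2 := hw u (bxor x v)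
  rw [hac x u v] at e2
  exact tr_bool_four _ _ _ _ _ (hw u x) e2

/-! ### The affineness test above `15/16` -/

/-- **No non-affine fibre above `15/16`.** For `f` cubic on `m + m` bits, `π` coordinatewise quadratic and `g` in
Maiorana–McFarland sign form with `Φ(f,g) > 15/16` (and the MM Walsh identity `hW`), every second coordinate
derivative of every fibre `f(π y ‖ ·)` vanishes:
`f(πy‖x) ⊕ f(πy‖x⊕eᵢ) ⊕ f(πy‖x⊕eⱼ) ⊕ f(πy‖x⊕eⱼ⊕eᵢ) = 0` — otherwise `≥ 2^m/4` fibres are non-affine cubics of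
bias `≤ 3/4` and `Φ ≤ 15/16` (the affineness test of `stub_mmFormCeiling`, with D = `stub_derivDegree` and
R = `bb_rmWeight_holds`). -/
theorem tr_coord_second_deriv_eq_false
    (hW : ∀ (m : ℕ) (f g : (Fin (m + m) → Bool) → Bool) (π : (Fin m → Bool) → (Fin m → Bool))
      (h : (Fin m → Bool) → Bool),
      (∀ y₁ y₂ : Fin m → Bool, signOf (g (Fin.append y₁ y₂)) = twist y₁ (π y₂) * signOf (h y₂)) →
      forrelation f g = ((2 : ℝ) ^ (2 * m))⁻¹ *
        ∑ y₂ : Fin m → Bool, signOf (h y₂) * ∑ x₂ : Fin m → Bool, signOf (f (Fin.append (π y₂) x₂)) * twist x₂ y₂)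
    {f g : (Fin (m + m) → Bool) → Bool} {π : (Fin m → Bool) → (Fin m → Bool)} {h : (Fin m → Bool) → Bool}
    (hf : IsDegLeFun 3 f) (hπ : ∀ i : Fin m, IsDegLeFun 2 (fun y => π y i))
    (hg : ∀ y₁ y₂ : Fin m → Bool, signOf (g (Fin.append y₁ y₂)) = twist y₁ (π y₂) * signOf (h y₂))
    (hΦ : 15 / 16 < forrelation f g) (y : Fin m → Bool) (i j : Fin m) (x : Fin m → Bool) :
    ((f (Fin.append (π y) x) ^^ f (Fin.append (π y) (bxor x (Pi.single i true)))) ^^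
      (f (Fin.append (π y) (bxor x (Pi.single j true))) ^^
        f (Fin.append (π y) (bxor (bxor x (Pi.single j true)) (Pi.single i true))))) = false := by
  classical
  refine Bool.eq_false_iff.2 fun hne => ?_
  obtain ⟨l, hl1, hl⟩ := fc_linForm_exists m
  -- coordinate directions of the second block, the two derivatives of `f`, the fibre functions `q y = f(π y ‖ ·) ⊕ ℓ_y`
  obtain ⟨T, hT⟩ : ∃ T : Fin m → Fin (m + m) → Bool, ∀ i, T i = Fin.append zeroVec (Pi.single i true) :=
    ⟨_, fun _ => rfl⟩
  obtain ⟨D1, hD1⟩ : ∃ D1 : Fin m → (Fin (m + m) → Bool) → Bool, ∀ i z, D1 i z = (f z ^^ f (bxor z (T i))) :=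
    ⟨fun i z => f z ^^ f (bxor z (T i)), fun _ _ => rfl⟩
  obtain ⟨D2, hD2⟩ : ∃ D2 : Fin m → Fin m → (Fin (m + m) → Bool) → Bool,
      ∀ i j z, D2 i j z = (D1 i z ^^ D1 i (bxor z (T j))) :=
    ⟨fun i j z => D1 i z ^^ D1 i (bxor z (T j)), fun _ _ _ => rfl⟩
  obtain ⟨q, hq⟩ : ∃ q : (Fin m → Bool) → (Fin m → Bool) → Bool,
      ∀ y x, q y x = (f (Fin.append (π y) x) ^^ l y x) := ⟨_, fun _ _ => rfl⟩
  have hD1deg : ∀ i, IsDegLeFun 2 (D1 i) := fun i => by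
    rw [show D1 i = fun z => (f z ^^ f (bxor z (T i))) from funext (hD1 i)]
    exact stub_derivDegree (m + m) 2 f (T i) hf
  have hD2deg : ∀ i j, IsDegLeFun 1 (D2 i j) := fun i j => by
    rw [show D2 i j = fun z => (D1 i z ^^ D1 i (bxor z (T j))) from funext (hD2 i j)]
    exact stub_derivDegree (m + m) 1 (D1 i) (T j) (hD1deg i)
  have hqdeg : ∀ y, IsDegLeFun 3 (q y) := fun y => by
    rw [show q y = fun x => (f (Fin.append (π y) x) ^^ l y x) from funext (hq y)]
    exact fc_deg_bxor (fc_isDegLeFun_comp hf (fun x => Fin.append (π y) x) (fc_deg_coord_append_left (π y))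
      (by norm_num)) ((hl1 y).mono (by norm_num))
  have hshift : ∀ (c x : Fin m → Bool) (i : Fin m),
      bxor (Fin.append c x) (T i) = Fin.append c (bxor x (Pi.single i true)) := fun c x i => by
    rw [hT, fc_bxor_append, bxor_zeroVec]
  -- first and second coordinate derivatives of the fibre functions
  have hR1 : ∀ y i x, (q y x ^^ q y (bxor x (Pi.single i true))) = (D1 i (Fin.append (π y) x) ^^ y i) := by
    intro y i x
    rw [hq, hq, hD1, hshift, (fc_lin_props (hl y)).1, (fc_lin_props (hl y)).2.1]
    exact fc_bool_id1 _ _ _ _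
  have hR2 : ∀ y i j x, ((D1 i (Fin.append (π y) x) ^^ y i) ^^
      (D1 i (Fin.append (π y) (bxor x (Pi.single j true))) ^^ y i)) = D2 i j (Fin.append (π y) x) :=
    fun y i j x => by
    rw [hD2, hshift]
    exact fc_bool_id2 _ _ _
  -- a fibre with a non-vanishing second derivative takes both values, hence has bias ≤ 3/4
  have fibA : ∀ y i j x₀, D2 i j (Fin.append (π y) x₀) = true → |∑ x, signOf (q y x)| ≤ 3 / 4 * (2 : ℝ) ^ m := by
    intro y i j x₀ hx₀
    obtain ⟨h1, h0⟩ := fc_fibre_both (q y) (fun i x => D1 i (Fin.append (π y) x) ^^ y i)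
      (fun i j x => D2 i j (Fin.append (π y) x)) (hR1 y) (hR2 y) hx₀
    exact fc_bias bb_rmWeight_holds (hqdeg y) h1 h0
  -- the witness: `y' ↦ D2 i j (π y' ‖ x)` is a nonzero function of degree ≤ 2
  have h₀ : D2 i j (Fin.append (π y) x) = true := by
    simp only [hD2, hD1, hshift]
    exact hne
  have hv : IsDegLeFun 2 (fun y' => D2 i j (Fin.append (π y') x)) :=
    fc_isDegLeFun_comp (hD2deg i j) (fun y' => Fin.append (π y') x) (fc_deg_coord_append_pi hπ x) (by norm_num)
  have hRv := (Nat.cast_le (α := ℝ)).2 (bb_rmWeight_holds m 2 _ hv ⟨y, h₀⟩)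
  push_cast at hRv
  have hcore := tr_avg_quarter (fun y' => ∑ x', signOf (q y' x')) (fun y' => fc_abs_sum_signOf_le (q y'))
    (univ.filter fun y' => D2 i j (Fin.append (π y') x) = true)
    (fun y' hy => fibA y' i j x (mem_filter.1 hy).2) (by linarith [hRv])
  -- Φ through the MM Walsh identity
  have hΦ' := hW m f g π h hg
  simp_rw [show ∀ y', ∑ x', signOf (f (Fin.append (π y') x')) * twist x' y' = ∑ x', signOf (q y' x') from
    fun y' => sum_congr rfl fun x' _ => by rw [hq, signOf_xor, hl]] at hΦ'
  have h2m : (2 : ℝ) ^ (2 * m) = 2 ^ m * 2 ^ m := by rw [two_mul, pow_add]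
  have hMpos : (0 : ℝ) < 2 ^ m * 2 ^ m := by positivity
  have hle : ∑ y', signOf (h y') * ∑ x', signOf (q y' x') ≤ ∑ y', |∑ x', signOf (q y' x')| :=
    sum_le_sum fun y' _ => (le_abs_self _).trans (by rw [abs_mul, abs_signOf, one_mul])
  rw [hΦ', h2m, lt_inv_mul_iff₀ hMpos] at hΦ
  linarith

/-- **stub tr_affine_of_mm_perm** (TRANSFER OF MM-SHAPE ACROSS A NEAR-EXACT PAIR). Given the MM Walsh identity (first
hypothesis; landed as `stub_mmWalsh`): for `f` cubic on `m + m` bits, `π` coordinatewise quadratic and surjective,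
`g` in Maiorana–McFarland sign form `(-1)^{g(y₁ ‖ y₂)} = (-1)^{y₁·π(y₂)} (-1)^{h(y₂)}` and `Φ(f,g) > 15/16`, every
restriction `f(x₁ ‖ ·)` is affine — all its second differences vanish. -/
theorem tr_affine_of_mm_perm :
    (∀ (m : ℕ) (f g : (Fin (m + m) → Bool) → Bool) (π : (Fin m → Bool) → (Fin m → Bool)) (h : (Fin m → Bool) → Bool),
      (∀ y₁ y₂ : Fin m → Bool, signOf (g (Fin.append y₁ y₂)) = twist y₁ (π y₂) * signOf (h y₂)) →
      forrelation f g = ((2 : ℝ) ^ (2 * m))⁻¹ *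
        ∑ y₂ : Fin m → Bool, signOf (h y₂) * ∑ x₂ : Fin m → Bool, signOf (f (Fin.append (π y₂) x₂)) * twist x₂ y₂) →
    ∀ (m : ℕ) (f g : (Fin (m + m) → Bool) → Bool) (π : (Fin m → Bool) → (Fin m → Bool)) (h : (Fin m → Bool) → Bool),
      IsDegLeFun 3 f → (∀ i : Fin m, IsDegLeFun 2 (fun y => π y i)) → Function.Surjective π →
      (∀ y₁ y₂ : Fin m → Bool, signOf (g (Fin.append y₁ y₂)) = twist y₁ (π y₂) * signOf (h y₂)) →
      15 / 16 < forrelation f g →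
      ∀ (x₁ u v x₂ : Fin m → Bool),
        (f (Fin.append x₁ x₂) ^^ f (Fin.append x₁ (bxor x₂ u)) ^^ f (Fin.append x₁ (bxor x₂ v)) ^^
          f (Fin.append x₁ (bxor x₂ (bxor u v)))) = false := by
  intro hW m f g π h hf hπ hsurj hg hΦ x₁ u v x₂
  obtain ⟨y, rfl⟩ := hsurj x₁
  exact tr_second_diff_of_coord (fun x => f (Fin.append (π y) x))
    (fun i j x => tr_coord_second_deriv_eq_false hW hf hπ hg hΦ y i j x) u v x₂

end Summit.QuantumAdvantage.QuantumAdvantage.Theorems.CubicForrelation.NearExactIsExact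

end
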